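import Literature.MathematicalPhysics.QuantumFieldTheory.Dimock2011to13.QED3SquarePartitionOfUnity
import Literature.MathematicalPhysics.QuantumFieldTheory.Dimock2011to13.LargeFieldRegionVolume
import Literature.MathematicalPhysics.QuantumFieldTheory.Balaban1983to89.B12Decay510Torus
import HarnessLib

/-!
# Dimock, *QED on the 3-torus. II*, §3.1 (124)–(126) ON THE TORUS: the partition of unity `h_□(x) = g((x − y)L^{k−i}∕M₀)`
# PERIODIZED on the discrete torus `(ℤ∕N)^d` (minimal lifts), «`Σ_□ h_□(x)² = 1`» (125) PROVED for every site of the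
# torus, «`supp h_□ ⊂ □̃`» as a sup-ball around the centre of `□`, and the Lipschitz bounds (145) ∕ (150)

statement-level skeleton of published theorems with citation tags; proofs where landed; nothing here is a claim about the Yang–Mills mass gap

**Citation header (reproduction of PUBLISHED work).** J. Dimock, *Quantum electrodynamics on the 3-torus. II. The
renormalization group flow*, arXiv:math-ph/0407063 (2004) [Dimock2004QED3TorusII], §3.1 «definitions» p.20 L82 – p.21
L15 with Remark 3 of §3.2 p.22 L28–30 (`Λ_i =` the full tori), of the held arXiv text layer `paper:arxiv-math-ph_0407063`
(`p.NN Lnn` = PDF page ∕ text-layer line).  Writer seat p11 (literature-prover-lit-balaban-p11-g24-0), YM LIT SWEEP item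
(c) D13 (row C13 «WHERE»; zero weight for the YM-INPRINT tokens).  Imports the tree's `QED3SquarePartitionOfUnity` (the
CONSTRUCTED `g` with `Σ_{n∈ℤ^d}g(x − n)² = 1`: `hasSum_g_sq`, `g_eq_zero_of_coord`), `LargeFieldRegionVolume` (`RegionVolume`:
the sup-balls `tball` of the torus carrier) and `Balaban1983to89.B12Decay510Torus` (`TPt d N = (ℤ∕N)^d`, minimal lifts
`valMinAbs`, `valMinAbs_intCast_of_two_mul_abs_lt`).

**The printed text (p.20 L82 – p.21 L15).** *"First take a smooth function `g` on `ℝ³` so `g` has support in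
`{x : |x| ≤ 2∕3}` and `g = 1` on `{x : |x| ≤ 1∕3}` and `Σ_{n∈ℤ³}g(x − n)² = 1`. Then if `□` is a `D_i` block … centered
on `y` …, we define `h_□(x) = g((x − y)L^{k−i}∕M₀)` (124) Then … `Σ_{□∈D}h_□(x)² = 1` (125) … `□̃ = 3M₀L^{−(k−i)}` cube
centered on `□` … We have `supp h_□ ⊂ □̃`."*  On the full torus (Remark 3) the sites are `x ∈ T^{−k}`, a discrete
torus, and `x − y` in (124) is the displacement ON THE TORUS.

**What is formalized (kernel-checked, zero `sorry`, no named facts).**  Sites: the torus `(ℤ∕N_s)^d` (`TPt d N_s`,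
site labels; `η = L^{−k}` the spacing); cubes: the torus `(ℤ∕N_c)^d`, `N_s = ℓ·N_c` (`ℓ = M₀L^{i}` sites per cube side on
one scale), the cube `w` having corner site `cz w = ℓ·w` (standard lift).  **The periodized (124)**:
`h_w(x) := g(ℓ^{−1}·valMinAbs(x − cz w) − t)` coordinatewise — `valMinAbs` the minimal lift of the torus displacement,
`t` the centre offset in cube units (`t = (ℓ − 1)∕(2ℓ)` puts `y` at the centre of the cube; any `t` is allowed).
* **(125) on the torus**, `sum_sq_g_torus_eq_one`: `Σ_{w∈(ℤ∕N_c)^d} h_w(x)² = 1` for EVERY site `x`, provided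
  `2|t| + 6∕5 < N_c` (for the centred `t ∈ [0,1∕2]`: at least three cubes per direction) — from the tree's
  `Σ_{n∈ℤ^d}g(z − n)² = 1` by grouping `n ∈ ℤ^d` into residues mod `N_c`: in each residue exactly the minimal lift can
  contribute (the support of `g` is narrower than half the period), `cz_proj_apply`, `exists_lift_eq_valMinAbs`.
* **«`supp h_□ ⊂ □̃`» on the torus**, `mem_tball_of_g_torus_ne_zero`: `h_w(x) ≠ 0 ⟹ x ∈ (cz w + τ)^{∼r}` (the sup-ball
  of `RegionVolume.tball`) for any integer `τ` with `|ℓt − τ| ≤ 1∕2` (the centre site) and any radius `r ≥ (3∕5)ℓ + 1∕2`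
  — the support of the tree's `g` is the sup-ball of radius `3∕5 < 2∕3`.
* **(145) ∕ (150) on the torus**, `abs_sub_g_torus_le`: `|h_w(x) − h_w(x′)| ≤ G·s∕ℓ` for `x′ ∈ x^{∼s}` (`G` any bound of
  `‖g′‖`, available by the tree's `exists_fderiv_g_le`; mean value inequality), provided the support window stays clear of
  the antipode (`ℓ(|t| + 3∕5) + s < N_s∕2`) — at a wrap of the minimal lift both values vanish; `s = 1`: (145), `s = L^{i}`: (150).

**Honest scope.**  Single scale (Remark 3); the boundary-face modification between scales (p.21 L5–9) and the
multiscale family `D` are not treated.  `g` is the tree's constructed bump (the paper fixes no formula).  The operator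
statements ((125) as `Σ_□h_□h_□ = 1` for multiplication operators, THEOREM 1 on the torus with this `h`) are assembled
elsewhere from this file.  No `d = 4` statement; nothing about Bałaban's papers beyond the reuse of the cell's torus carrier.
-/

noncomputable section

namespace Literature.MathematicalPhysics.QuantumFieldTheory.Dimock2011to13

namespace QED3TorusII

open Finset Real
open QED3SquarePartition (g g_eq_zero_of_coord hasSum_g_sq)
open Balaban1983to89.B13ScaleTransfer (Pt)
open Balaban1983to89.TreeLengthTorus (TPt proj natLift proj_natLift)
open Balaban1983to89.TreeLengthTorusGeometry (period proj_add_period exists_period_of_proj_eq)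
open Balaban1983to89.B12Decay510Torus (valMinAbs_intCast_of_two_mul_abs_lt)
open RegionVolume (box mem_box tball mem_tball)

variable {dd : ℕ} {Ns Nc ℓ : ℕ} [NeZero Ns] [NeZero Nc]

/-! ## §1 Cube corners on the site torus and lifts -/

omit [NeZero Nc] in
/-- a site label is the residue of its standard lift, coordinatewise. [folklore] -/
private theorem apply_eq_cast_natLift (x : TPt dd Ns) (i : Fin dd) : x i = ((natLift x i : ℤ) : ZMod Ns) := by
  have := congrFun (proj_natLift x) i
  exact this.symm

omit [NeZero Ns] in
/-- **the corner of the cube of a lattice vector**: for `n ∈ ℤ^d` with residue `w = n mod N_c`, the corner site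
`cz w = ℓ·w` has coordinates `ℓ·n_i mod N_s` (`N_s = ℓN_c`). [cite: Dimock2004QED3TorusII, §3.1 (124) p.20 L85–93 («□ … centered on y»)] -/
theorem cz_proj_apply (hmod : Ns = ℓ * Nc) {cz : TPt dd Nc → TPt dd Ns}
    (hcz : ∀ w, cz w = proj Ns fun i => (ℓ : ℤ) * natLift w i) (n : Pt dd) (i : Fin dd) :
    cz (proj Nc n) i = (((ℓ : ℤ) * n i : ℤ) : ZMod Ns) := by
  obtain ⟨q, hq⟩ := exists_period_of_proj_eq (N := Nc) (x := n) (y := natLift (proj Nc n))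
    (by rw [proj_natLift])
  rw [hcz, hq]
  show (((ℓ : ℤ) * (n + period Nc q) i : ℤ) : ZMod Ns) = _
  simp only [Pi.add_apply, period]
  have e : (ℓ : ℤ) * (n i + (Nc : ℤ) * q i) = ℓ * n i + (Ns : ℤ) * q i := by
    rw [hmod]; push_cast; ring
  rw [e]
  push_cast
  rw [ZMod.natCast_self, zero_mul, add_zero]

/-- the torus displacement `x − cz w` of a site from the corner of the cube of residue `n mod N_c` is the residue of
`natLift x − ℓn`. [cite: Dimock2004QED3TorusII, §3.1 (124) p.20 L85–93] -/
theorem sub_cz_proj_apply (hmod : Ns = ℓ * Nc) {cz : TPt dd Nc → TPt dd Ns}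
    (hcz : ∀ w, cz w = proj Ns fun i => (ℓ : ℤ) * natLift w i) (x : TPt dd Ns) (n : Pt dd) (i : Fin dd) :
    (x - cz (proj Nc n)) i = ((natLift x i - (ℓ : ℤ) * n i : ℤ) : ZMod Ns) := by
  rw [Pi.sub_apply, cz_proj_apply hmod hcz, apply_eq_cast_natLift x i, Int.cast_sub]

/-- **every cube has a lattice representative realizing the minimal lift**: for each cube `w` there is `n ∈ ℤ^d` of residue
`w` with `natLift x − ℓn = valMinAbs(x − cz w)` coordinatewise. [cite: Dimock2004QED3TorusII, §3.1 (124)–(126) p.20 L85 – p.21 L15] -/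
theorem exists_lift_eq_valMinAbs (hmod : Ns = ℓ * Nc) {cz : TPt dd Nc → TPt dd Ns}
    (hcz : ∀ w, cz w = proj Ns fun i => (ℓ : ℤ) * natLift w i) (x : TPt dd Ns) (w : TPt dd Nc) :
    ∃ n : Pt dd, proj Nc n = w ∧ ∀ i, natLift x i - (ℓ : ℤ) * n i = ((x - cz w) i).valMinAbs := by
  have hk : ∀ i, ∃ k : ℤ, natLift x i - (ℓ : ℤ) * natLift w i = ((x - cz w) i).valMinAbs + (Ns : ℤ) * k := by
    intro i
    have hc : (((natLift x i - (ℓ : ℤ) * natLift w i : ℤ)) : ZMod Ns)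
        = ((((x - cz w) i).valMinAbs : ℤ) : ZMod Ns) := by
      rw [ZMod.coe_valMinAbs, ← proj_natLift w, sub_cz_proj_apply hmod hcz x (natLift w) i, proj_natLift]
    obtain ⟨k, hk⟩ := (ZMod.intCast_eq_intCast_iff_dvd_sub _ _ _).1 hc.symm
    exact ⟨k, by linarith⟩
  choose k hk using hk
  refine ⟨fun i => natLift w i + (Nc : ℤ) * k i, ?_, fun i => ?_⟩
  · have e : (fun i => natLift w i + (Nc : ℤ) * k i) = natLift w + period Nc k := by
      funext i; simp [period]
    rw [e, proj_add_period, proj_natLift]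
  · have e := hk i
    have hNs : (Ns : ℤ) = (ℓ : ℤ) * Nc := by exact_mod_cast hmod
    show natLift x i - (ℓ : ℤ) * (natLift w i + (Nc : ℤ) * k i) = ((x - cz w) i).valMinAbs
    linear_combination e + k i * hNs

/-! ## §2 (125) on the torus -/

/-- **(125) ON THE TORUS: `Σ_□ h_□(x)² = 1` at every site**, for the periodized (124)
`h_w(x) = g(ℓ^{−1}·valMinAbs(x − cz w) − t)` over all cubes `w ∈ (ℤ∕N_c)^d` of the torus (`N_s = ℓN_c` sites per direction,
`2|t| + 6∕5 < N_c`). [cite: Dimock2004QED3TorusII, §3.1 (124)–(125) p.20 L82 – p.21 L4 and §3.2 Remark 3 p.22 L28–30] -/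
theorem sum_sq_g_torus_eq_one [NeZero ℓ] (hmod : Ns = ℓ * Nc) (t : ℝ) (hNc : 2 * |t| + 6 / 5 < (Nc : ℝ))
    {cz : TPt dd Nc → TPt dd Ns} (hcz : ∀ w, cz w = proj Ns fun i => (ℓ : ℤ) * natLift w i) (x : TPt dd Ns) :
    ∑ w : TPt dd Nc, g (fun i => (ℓ : ℝ)⁻¹ * (((x - cz w) i).valMinAbs : ℝ) - t) ^ 2 = 1 := by
  classical
  have hℓ : 0 < ℓ := Nat.pos_of_ne_zero (NeZero.ne ℓ)
  have hℓr : (0 : ℝ) < ℓ := by exact_mod_cast hℓ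
  set X : Pt dd := natLift x with hX
  -- the `ℤ^d` family of the tree's identity `Σ_n g(z − n)² = 1`
  set z : Fin dd → ℝ := fun i => (ℓ : ℝ)⁻¹ * (X i : ℝ) - t with hz
  set f : (Fin dd → ℤ) → ℝ := fun n => g (z - fun i => (n i : ℝ)) ^ 2 with hf
  have hsum : HasSum f 1 := hasSum_g_sq z
  have hfu : ∀ n : Fin dd → ℤ, f n = g (fun i => (ℓ : ℝ)⁻¹ * ((X i - (ℓ : ℤ) * n i : ℤ) : ℝ) - t) ^ 2 := by
    intro n
    simp only [hf, hz]
    congr 2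
    funext i
    simp only [Pi.sub_apply]
    push_cast
    field_simp
    ring
  -- the representative of each cube realizing the minimal lift
  choose nstar hproj hnstar using exists_lift_eq_valMinAbs hmod hcz x
  have hinj : Function.Injective nstar := fun w w' h => by rw [← hproj w, ← hproj w', h]
  have hval : ∀ w, f (nstar w) = g (fun i => (ℓ : ℝ)⁻¹ * (((x - cz w) i).valMinAbs : ℝ) - t) ^ 2 := by
    intro w
    rw [hfu]
    congr 2
    funext i
    rw [hnstar w i]
  -- off the representatives the family vanishes: a contributing lattice vector realizes the minimal lift of its residue
  have hzero : ∀ n ∉ (univ : Finset (TPt dd Nc)).image nstar, f n = 0 := by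
    intro n hn
    by_contra hne
    apply hn
    have hne' : g (fun i => (ℓ : ℝ)⁻¹ * ((X i - (ℓ : ℤ) * n i : ℤ) : ℝ) - t) ≠ 0 := by
      intro h0
      apply hne
      rw [hfu, h0, zero_pow two_ne_zero]
    have hsmall : ∀ i, 2 * |X i - (ℓ : ℤ) * n i| < (Ns : ℤ) := by
      intro i
      have hlt : |(ℓ : ℝ)⁻¹ * ((X i - (ℓ : ℤ) * n i : ℤ) : ℝ) - t| < 3 / 5 := by
        by_contra hge
        rw [not_lt] at hge
        exact hne' (g_eq_zero_of_coord (μ := i) hge)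
      have h1 : |(ℓ : ℝ)⁻¹ * ((X i - (ℓ : ℤ) * n i : ℤ) : ℝ)| < |t| + 3 / 5 := by
        have := abs_sub_abs_le_abs_sub ((ℓ : ℝ)⁻¹ * ((X i - (ℓ : ℤ) * n i : ℤ) : ℝ)) t
        linarith
      rw [abs_mul, abs_of_pos (inv_pos.2 hℓr), inv_mul_lt_iff₀ hℓr] at h1
      have h3 : (2 : ℝ) * |((X i - (ℓ : ℤ) * n i : ℤ) : ℝ)| < Ns := by
        have e : (Ns : ℝ) = ℓ * Nc := by rw [hmod]; push_cast; ring
        rw [e]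
        nlinarith [hNc, hℓr, abs_nonneg (((X i - (ℓ : ℤ) * n i : ℤ) : ℝ))]
      have h4 : (((2 * |X i - (ℓ : ℤ) * n i| : ℤ)) : ℝ) < ((Ns : ℤ) : ℝ) := by
        push_cast at h3 ⊢
        exact h3
      exact_mod_cast h4
    set w : TPt dd Nc := proj Nc n with hw
    refine mem_image.2 ⟨w, mem_univ _, ?_⟩
    have hvma : ∀ i, ((x - cz w) i).valMinAbs = X i - (ℓ : ℤ) * n i := by
      intro i
      rw [hw, sub_cz_proj_apply hmod hcz x n i]
      exact valMinAbs_intCast_of_two_mul_abs_lt (hsmall i)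
    funext i
    have e := hnstar w i
    rw [hvma i] at e
    have e' : (ℓ : ℤ) * nstar w i = (ℓ : ℤ) * n i := by linarith
    exact mul_left_cancel₀ (by exact_mod_cast hℓ.ne') e'
  have h2 := hsum.unique (hasSum_sum_of_ne_finset_zero hzero)
  rw [sum_image fun w _ w' _ h => hinj h] at h2
  simp_rw [hval] at h2
  exact h2.symm

/-! ## §3 «supp h_□ ⊂ □̃» on the torus -/

omit [NeZero Ns] [NeZero Nc] in
/-- **the support of the periodized (124)**: `h_w(x) ≠ 0 ⟹ x ∈ (cz w + τ)^{∼r}` — the sup-ball (`RegionVolume.tball`) of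
radius `r ≥ (3∕5)ℓ + 1∕2` around the centre site `cz w + τ·(1,…,1)` of the cube (`τ` an integer within `1∕2` of `ℓt`); in
particular `supp h_□ ⊂ □̃` (`□̃` has radius `(3∕2)ℓ`). [cite: Dimock2004QED3TorusII, §3.1 (124), (126) p.20 L85 – p.21 L15 («We have supp h_□ ⊂ □̃»)] -/
theorem mem_tball_of_g_torus_ne_zero [NeZero ℓ] {t : ℝ} {τ : ℤ} (hτ : |(ℓ : ℝ) * t - τ| ≤ 1 / 2) {r : ℕ}
    (hr : (3 / 5 : ℝ) * ℓ + 1 / 2 ≤ r) (cz : TPt dd Nc → TPt dd Ns) (w : TPt dd Nc) (x : TPt dd Ns)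
    (hx : g (fun i => (ℓ : ℝ)⁻¹ * (((x - cz w) i).valMinAbs : ℝ) - t) ≠ 0) :
    x ∈ tball (cz w + proj Ns fun _ => τ) r := by
  have hℓ : 0 < ℓ := Nat.pos_of_ne_zero (NeZero.ne ℓ)
  have hℓr : (0 : ℝ) < ℓ := by exact_mod_cast hℓ
  refine mem_tball.2 ⟨fun i => ((x - cz w) i).valMinAbs - τ, mem_box.2 fun i => ?_, ?_⟩
  · have hlt : |(ℓ : ℝ)⁻¹ * (((x - cz w) i).valMinAbs : ℝ) - t| < 3 / 5 := by
      by_contra hge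
      rw [not_lt] at hge
      exact hx (g_eq_zero_of_coord (μ := i) hge)
    -- `|v − τ| ≤ |v − ℓt| + |ℓt − τ| < (3∕5)ℓ + 1∕2 ≤ r`
    have h1 : |(((x - cz w) i).valMinAbs : ℝ) - ℓ * t| < 3 / 5 * ℓ := by
      have e : (((x - cz w) i).valMinAbs : ℝ) - ℓ * t
          = ℓ * ((ℓ : ℝ)⁻¹ * (((x - cz w) i).valMinAbs : ℝ) - t) := by field_simp
      rw [e, abs_mul, abs_of_pos hℓr]
      calc (ℓ : ℝ) * |(ℓ : ℝ)⁻¹ * (((x - cz w) i).valMinAbs : ℝ) - t| < ℓ * (3 / 5) :=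
            mul_lt_mul_of_pos_left hlt hℓr
        _ = 3 / 5 * ℓ := by ring
    have h2 : |((((x - cz w) i).valMinAbs - τ : ℤ) : ℝ)| ≤ r := by
      push_cast
      have := abs_sub_le (((x - cz w) i).valMinAbs : ℝ) (ℓ * t) τ
      linarith
    have h3 : |((x - cz w) i).valMinAbs - τ| ≤ (r : ℤ) := by exact_mod_cast h2
    constructor
    · linarith [(abs_le.1 h3).1]
    · linarith [(abs_le.1 h3).2]
  · -- `x = cz w + τ + (valMinAbs(x − cz w) − τ)`
    funext i
    simp only [Pi.add_apply, proj, Int.cast_sub, ZMod.coe_valMinAbs, Pi.sub_apply]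
    ring


/-! ## §4 (145) ∕ (150) on the torus: the periodized `h_□` is Lipschitz in the torus displacement -/

omit [NeZero Nc] in
/-- the mean value inequality for the tree's bump `g`: `|g(p) − g(q)| ≤ G‖p − q‖` for any bound `G` of `‖g′‖` (sup norm).
[cite: Dimock2004QED3TorusII, §3.2 Thm 1 proof Part II (145) p.23 L66–69 («sup_x|∂h_□(x)|»)] -/
theorem abs_g_sub_g_le {G : ℝ} (hG : ∀ z : Fin dd → ℝ, ‖fderiv ℝ (g : (Fin dd → ℝ) → ℝ) z‖ ≤ G) (p q : Fin dd → ℝ) :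
    |g p - g q| ≤ G * ‖p - q‖ := by
  have hdiff : ∀ z : Fin dd → ℝ, DifferentiableAt ℝ (g : (Fin dd → ℝ) → ℝ) z := fun z =>
    (QED3SquarePartition.contDiff_g (m := 1) (ι := Fin dd)).differentiable (by norm_num) z
  have h := Convex.norm_image_sub_le_of_norm_fderiv_le (f := (g : (Fin dd → ℝ) → ℝ)) (s := Set.univ)
    (fun z _ => hdiff z) (fun z _ => hG z) convex_univ (Set.mem_univ q) (Set.mem_univ p)
  rw [Real.norm_eq_abs] at h
  exact h

omit [NeZero Nc] in
/-- **(145) ∕ (150) ON THE TORUS**: for sites `x′ ∈ x^{∼s}` (sup-ball of the site torus) the periodized (124) satisfies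
`|h_w(x) − h_w(x′)| ≤ G·s∕ℓ` — provided the support window stays clear of the antipode (`ℓ(|t| + 3∕5) + s < N_s∕2`); at a
wrap of the minimal lift both values vanish.  With `s = 1` (nearest neighbours, `ℓ = M₀L^{i}` sites): (145)
`L^k|h_□(x) − h_□(x′)| ≤ G·L^{k−i}∕M₀`; with `s = L^{i}` (one block): (150) `|h_□(x) − h_□(x′)| ≤ G∕M₀`.
[cite: Dimock2004QED3TorusII, §3.2 Thm 1 proof Part II (145) p.23 L66–69 and (150) p.24 L38–42] -/
theorem abs_sub_g_torus_le [NeZero ℓ] {t G : ℝ} (hG : ∀ z : Fin dd → ℝ, ‖fderiv ℝ (g : (Fin dd → ℝ) → ℝ) z‖ ≤ G)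
    {s : ℕ} (hwin : (ℓ : ℝ) * (|t| + 3 / 5) + s < (Ns : ℝ) / 2) (cz : TPt dd Nc → TPt dd Ns) (w : TPt dd Nc)
    {x x' : TPt dd Ns} (hx' : x' ∈ tball x s) :
    |g (fun i => (ℓ : ℝ)⁻¹ * (((x - cz w) i).valMinAbs : ℝ) - t)
        - g (fun i => (ℓ : ℝ)⁻¹ * (((x' - cz w) i).valMinAbs : ℝ) - t)| ≤ G * ((ℓ : ℝ)⁻¹ * s) := by
  have hℓ : 0 < ℓ := Nat.pos_of_ne_zero (NeZero.ne ℓ)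
  have hℓr : (0 : ℝ) < ℓ := by exact_mod_cast hℓ
  have hG0 : 0 ≤ G := (norm_nonneg _).trans (hG 0)
  obtain ⟨v, hv, hxv⟩ := mem_tball.1 hx'
  -- the displacements as integer vectors
  set a : Fin dd → ℤ := fun i => ((x - cz w) i).valMinAbs with ha
  set a' : Fin dd → ℤ := fun i => ((x' - cz w) i).valMinAbs with ha'
  by_cases hcase : ∀ i, a' i = a i + v i
  · -- no wrap: the arguments differ by `ℓ⁻¹v`
    have h := abs_g_sub_g_le hG (fun i => (ℓ : ℝ)⁻¹ * (a i : ℝ) - t) (fun i => (ℓ : ℝ)⁻¹ * (a' i : ℝ) - t)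
    refine h.trans (mul_le_mul_of_nonneg_left ?_ hG0)
    refine (pi_norm_le_iff_of_nonneg (by positivity)).2 fun i => ?_
    rw [Real.norm_eq_abs]
    simp only [Pi.sub_apply, hcase i, Int.cast_add]
    have hvi := mem_box.1 hv i
    have h1 : |(v i : ℝ)| ≤ s := by
      rw [← Int.cast_abs]; exact_mod_cast abs_le.2 ⟨hvi.1, hvi.2⟩
    rw [show (ℓ : ℝ)⁻¹ * (a i : ℝ) - t - ((ℓ : ℝ)⁻¹ * ((a i : ℝ) + (v i : ℝ)) - t) = -((ℓ : ℝ)⁻¹ * (v i : ℝ)) by ring,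
      abs_neg, abs_mul, abs_of_pos (inv_pos.2 hℓr)]
    exact mul_le_mul_of_nonneg_left h1 (inv_pos.2 hℓr).le
  · -- a wrap in some coordinate: both values vanish
    push Not at hcase
    obtain ⟨i, hi⟩ := hcase
    -- `a' i ≡ a i + v i (mod N_s)`
    have hcong : ((a' i : ℤ) : ZMod Ns) = ((a i + v i : ℤ) : ZMod Ns) := by
      simp only [ha, ha', Int.cast_add, ZMod.coe_valMinAbs, hxv, Pi.sub_apply, Pi.add_apply, proj]
      ring
    obtain ⟨k, hk⟩ := (ZMod.intCast_eq_intCast_iff_dvd_sub _ _ _).1 hcong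
    -- hk : a i + v i - a' i = Ns * k, with k ≠ 0
    have hk0 : k ≠ 0 := by
      rintro rfl
      apply hi
      linarith
    have hNs1 : (Ns : ℤ) ≤ |a i + v i - a' i| := by
      rw [hk, abs_mul, Nat.abs_cast]
      have : 1 ≤ |k| := Int.one_le_abs hk0
      nlinarith [this, (Nat.cast_nonneg Ns : (0 : ℤ) ≤ Ns)]
    have hai : (a i).natAbs ≤ Ns / 2 := ZMod.natAbs_valMinAbs_le _
    have ha'i : (a' i).natAbs ≤ Ns / 2 := ZMod.natAbs_valMinAbs_le _
    have hvi := mem_box.1 hv i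
    -- real versions
    have rNs : ((Ns : ℤ) : ℝ) ≤ |((a i : ℝ) + v i - a' i)| := by
      have h1 : ((Ns : ℤ) : ℝ) ≤ (((|a i + v i - a' i| : ℤ)) : ℝ) := by exact_mod_cast hNs1
      rw [Int.cast_abs] at h1
      push_cast at h1 ⊢
      exact h1
    have rai : |(a i : ℝ)| ≤ (Ns : ℝ) / 2 := by
      have h1 : ((a i).natAbs : ℝ) ≤ ((Ns / 2 : ℕ) : ℝ) := by exact_mod_cast hai
      rw [Nat.cast_natAbs, Int.cast_abs] at h1
      exact h1.trans (Nat.cast_div_le.trans (by norm_num))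
    have ra'i : |(a' i : ℝ)| ≤ (Ns : ℝ) / 2 := by
      have h1 : ((a' i).natAbs : ℝ) ≤ ((Ns / 2 : ℕ) : ℝ) := by exact_mod_cast ha'i
      rw [Nat.cast_natAbs, Int.cast_abs] at h1
      exact h1.trans (Nat.cast_div_le.trans (by norm_num))
    have rvi : |(v i : ℝ)| ≤ s := by
      rw [← Int.cast_abs]; exact_mod_cast abs_le.2 ⟨hvi.1, hvi.2⟩
    have rNs' : (Ns : ℝ) ≤ |(a i : ℝ) + v i - a' i| := by exact_mod_cast rNs
    -- hence both `|a i|` and `|a′ i|` exceed `N_s∕2 − s`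
    have hbig : (Ns : ℝ) / 2 - s ≤ |(a i : ℝ)| ∧ (Ns : ℝ) / 2 - s ≤ |(a' i : ℝ)| := by
      have t1 := abs_add_le ((a i : ℝ) + v i) (-(a' i : ℝ))
      have t2 := abs_add_le (a i : ℝ) (v i : ℝ)
      rw [← sub_eq_add_neg] at t1
      rw [abs_neg] at t1
      constructor <;> linarith
    -- and so both bump values vanish
    have hz : ∀ (b : Fin dd → ℤ), (Ns : ℝ) / 2 - s ≤ |(b i : ℝ)| →
        g (fun j => (ℓ : ℝ)⁻¹ * (b j : ℝ) - t) = 0 := by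
      intro b hb
      apply g_eq_zero_of_coord (μ := i)
      -- `|ℓ⁻¹ b i − t| ≥ ℓ⁻¹|b i| − |t| ≥ 3/5`
      have h1 : (ℓ : ℝ)⁻¹ * |(b i : ℝ)| - |t| ≤ |(ℓ : ℝ)⁻¹ * (b i : ℝ) - t| := by
        have := abs_sub_abs_le_abs_sub ((ℓ : ℝ)⁻¹ * (b i : ℝ)) t
        rw [abs_mul, abs_of_pos (inv_pos.2 hℓr)] at this
        exact this
      have h2 : |t| + 3 / 5 < (ℓ : ℝ)⁻¹ * ((Ns : ℝ) / 2 - s) := by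
        rw [lt_inv_mul_iff₀ hℓr]; linarith
      have h3 : (ℓ : ℝ)⁻¹ * ((Ns : ℝ) / 2 - s) ≤ (ℓ : ℝ)⁻¹ * |(b i : ℝ)| :=
        mul_le_mul_of_nonneg_left hb (inv_pos.2 hℓr).le
      linarith
    have e1 : g (fun j => (ℓ : ℝ)⁻¹ * (((x - cz w) j).valMinAbs : ℝ) - t) = 0 := hz a hbig.1
    have e2 : g (fun j => (ℓ : ℝ)⁻¹ * (((x' - cz w) j).valMinAbs : ℝ) - t) = 0 := hz a' hbig.2
    rw [e1, e2, sub_zero, abs_zero]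
    positivity

end QED3TorusII

end Literature.MathematicalPhysics.QuantumFieldTheory.Dimock2011to13
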